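import Literature.Probability.RandomPlanarGeometry.HexSAWBrickWallStripFugacityWidthOneComplexTaylor
import Literature.Probability.RandomPlanarGeometry.HexSAWBrickWallStripFugacityWidthOneContactDensity
import HarnessLib

/-!
# The Taylor data of the complex Perron root ARE the contact cumulants: `a = 2s·b(y,z)` and `γ = σ² = ∂b/∂A`

Topic `Literature/Probability/RandomPlanarGeometry` (continues `…WidthOneComplexTaylor.lean` — the Perron root `s(t)` of the two-wall cubic at fugacity
`ye^{it}` satisfies `‖log(s(t)/s) − iαt + γt²‖ ≤ K|t|³` with `α = a/s`, `γ = (a/2 + b_T)/s − α²/2`, `a = perronTaylorA`, `b_T = perronTaylorB` explicit —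
and `…WidthOneContactDensity.lean` — the contact density `b(y,z) = s(s−z)/(2F(s))` and `d/dA log μ₁(e^A,z) = b(e^A,z)`).  For the Berry–Esseen
assembly (DOOR-ap5-g27 item 1, brick B9) the first two cumulants read off the complex root must be the centring `b` and the CLT variance
`σ² = d/dA b(e^A,z)|_{A = log y}` of the tree's `tendsto_contactLaw`.  THIS FILE proves exactly these identities:

* `perronTaylorA_eq_two_mul_contactB` — `a = 2·s·b(y,z)`, i.e. `α = a/s = 2b` (the sextic law `s(s−y)(s−z) = yz`).
* `cofactor_at_root_eq_sexticDeriv` — `s² + (s − y − z)s + yz/s = F(s) = (s−y)(s−z) + s(s−z) + s(s−y)` (the denominator of the explicit parity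
  amplitude `LinearRecurrenceLimitFormula.norm_parity_sub_limitFormula_mul_pow_le` at `t = 0` is the positive number `F(s)`).
* `hasDerivAt_stripMuY₂_sq_exp` — `d/dA μ₁(e^A,z)² = 2·b(e^A,z)·μ₁(e^A,z)²`.
* ★★ `hasDerivAt_contactB_exp_perron` / `deriv_contactB_exp_eq_perron` — **`d/dA b(e^A, z) = (a/2 + b_T)/s − (a/s)²/2 = γ`** at every `A`
  (implicit differentiation of `b = s(s−z)/(2F)` along `y = e^A`, `ds/dA = a`); hence the CLT variance `σ²` of `…WidthOneContactCLT` IS the quadratic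
  cumulant `γ` of the complex Perron root, and `0 < γ`.

## Sources
N. R. Beaton, M. Bousquet-Mélou, J. de Gier, H. Duminil-Copin, A. J. Guttmann, CMP 326 (2014), arXiv:1109.0358v5 §3.2 Proposition 6 (p. 10: `μ₁(y,z)` and the
sextic law); A. Dembo, O. Zeitouni, *Large Deviations Techniques and Applications* (2010) §2.3 (cumulants of tilted laws).  Lane statements (lane «pcv-sawmu»,
a-p5 g28); nothing is quoted AS PRINTED.
-/

noncomputable section

open Complex
open Literature.Probability.LatticeModels Literature.Probability.Percolation

namespace Literature.Probability.RandomPlanarGeometry.SAW.HexBW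

namespace WidthOneYZ

variable {y z : ℝ}

/-! ## §1 The first cumulant: `a = 2 s b` -/

/-- **`a = 2·μ₁(y,z)²·b(y,z)`**: the first `(e^{it} − 1)`-Taylor coefficient of the complex Perron root is twice the contact density times `s = μ₁²`
(so `α = a/s = 2b(y,z)`: the phase velocity of `s(t)^{N/2}` is exactly the centring `N·b` of the contact number).  By the sextic law
`s(s−y)(s−z) = yz`: `y(s² − sz + z) = s²(s − z)`. [cite: BeatonBousquetMelouDeGierDuminilCopinGuttmann2014, §3.2 Proposition 6 (arXiv v5 p. 10; lane computation)] -/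
theorem perronTaylorA_eq_two_mul_contactB (hy : 0 < y) (hz : 0 < z) :
    perronTaylorA y z = 2 * stripMuY₂ 1 y z ^ 2 * contactB y z := by
  obtain ⟨hys, hzs, hF, hsex, -, -⟩ := contactB_facts hy hz
  set s := stripMuY₂ 1 y z ^ 2 with hs
  have hFdef : sexticDeriv y z s = (s - y) * (s - z) + s * (s - z) + s * (s - y) := rfl
  rw [hFdef] at hF
  have hnum : y * (s * s - z * s + z) = s * (s * (s - z)) := by linear_combination (-1 : ℝ) * hsex
  unfold perronTaylorA contactB
  rw [← hs, hFdef, hnum]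
  field_simp

/-- **The cofactor of the sextic cubic at its Perron root is `F(s)`**: `s² + (s − y − z)s + yz/s = (s−y)(s−z) + s(s−z) + s(s−y)` (`s = μ₁(y,z)²`; multiply
by `s` and use `s(s−y)(s−z) = yz`).  This is the (positive) denominator of the explicit parity amplitude at real fugacity.
[cite: BeatonBousquetMelouDeGierDuminilCopinGuttmann2014, §3.2 Proposition 6 (arXiv v5 p. 10; lane computation); Stanley2012EC1, §4.1 Theorem 4.1.1 (iii)] -/
theorem cofactor_at_root_eq_sexticDeriv (hy : 0 < y) (hz : 0 < z) :
    stripMuY₂ 1 y z ^ 2 * stripMuY₂ 1 y z ^ 2 + (stripMuY₂ 1 y z ^ 2 - y - z) * stripMuY₂ 1 y z ^ 2 + y * z / stripMuY₂ 1 y z ^ 2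
      = sexticDeriv y z (stripMuY₂ 1 y z ^ 2) := by
  obtain ⟨hys, hzs, hF, hsex, -, -⟩ := contactB_facts hy hz
  set s := stripMuY₂ 1 y z ^ 2 with hs
  have hs0 : s ≠ 0 := (hy.trans hys).ne'
  unfold sexticDeriv
  field_simp
  linear_combination (-1 : ℝ) * hsex

/-! ## §2 The second cumulant: `γ = ∂b/∂A = σ²` -/

/-- **`d/dA μ₁(e^A, z)² = 2·b(e^A,z)·μ₁(e^A,z)²`** (`μ₁² = exp(2 log μ₁)` and `d/dA log μ₁(e^A,z) = b(e^A,z)`, tree `hasDerivAt_log_stripMuY₂_exp`).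
[cite: BeatonBousquetMelouDeGierDuminilCopinGuttmann2014, §3.2 Proposition 6 (arXiv v5 p. 10); DemboZeitouni2010, §2.3 (lane statement)] -/
theorem hasDerivAt_stripMuY₂_sq_exp (hz : 0 < z) (A : ℝ) :
    HasDerivAt (fun A => stripMuY₂ 1 (Real.exp A) z ^ 2) (2 * contactB (Real.exp A) z * stripMuY₂ 1 (Real.exp A) z ^ 2) A := by
  have h := hasDerivAt_log_stripMuY₂_exp hz A
  have h2 : HasDerivAt (fun A => Real.exp (2 * Real.log (stripMuY₂ 1 (Real.exp A) z)))
      (Real.exp (2 * Real.log (stripMuY₂ 1 (Real.exp A) z)) * (2 * contactB (Real.exp A) z)) A :=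
    (h.const_mul 2).exp
  have hfun : (fun A => Real.exp (2 * Real.log (stripMuY₂ 1 (Real.exp A) z))) = fun A => stripMuY₂ 1 (Real.exp A) z ^ 2 := by
    funext A
    have hμ : 0 < stripMuY₂ 1 (Real.exp A) z := stripMuY₂_pos 1 (Real.exp_pos A) hz
    rw [show (2 : ℝ) * Real.log _ = ((2 : ℕ) : ℝ) * Real.log (stripMuY₂ 1 (Real.exp A) z) by norm_num, Real.exp_nat_mul, Real.exp_log hμ]
  rw [hfun] at h2
  have hμ : 0 < stripMuY₂ 1 (Real.exp A) z := stripMuY₂_pos 1 (Real.exp_pos A) hz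
  have e : Real.exp (2 * Real.log (stripMuY₂ 1 (Real.exp A) z)) = stripMuY₂ 1 (Real.exp A) z ^ 2 := by
    rw [show (2 : ℝ) * Real.log _ = ((2 : ℕ) : ℝ) * Real.log (stripMuY₂ 1 (Real.exp A) z) by norm_num, Real.exp_nat_mul, Real.exp_log hμ]
  rw [e] at h2
  convert h2 using 1
  ring

/-- The algebra of the second cumulant, with ATOMIC denominators: `q = s² − zs + z`, `P = F·q`; `y = s²(s−z)/q` (the sextic law solved for `y`),
`F = P/q`, `b = s(s−z)q/(2P)`, `a = s²(s−z)q/P`, `b_T = (y(2s−z)a − (3s−z−y)a²)q/P`; then the derivative of `b = s(s−z)/(2F(y,s))` along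
`(ẏ, ṡ) = (y, 2bs)` equals `(a/2 + b_T)/s − (a/s)²/2` — a polynomial identity in `s, z` after clearing `q, P, s`.
[cite: BeatonBousquetMelouDeGierDuminilCopinGuttmann2014, §3.2 Proposition 6 (arXiv v5 p. 10; lane computation)] -/
private theorem second_cumulant_algebra {s y z q P a b bT : ℝ} (hs0 : s ≠ 0) (hq0 : q ≠ 0) (hP0 : P ≠ 0)
    (hq : q = s * s - z * s + z) (hP : P = 3 * s * s * q - 2 * s ^ 3 * (s - z) - 2 * z * s * q + z * s * s * (s - z))
    (hy : y = s * s * (s - z) / q) (hF : (s - y) * (s - z) + s * (s - z) + s * (s - y) = P / q)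
    (hb : b = s * (s - z) * q / (2 * P)) (ha : a = s * s * (s - z) * q / P)
    (hbT : bT = (y * (2 * s - z) * a - (3 * s - z - y) * a ^ 2) * q / P) :
    ((2 * b * s * (s - z) + s * (2 * b * s)) * (2 * ((s - y) * (s - z) + s * (s - z) + s * (s - y)))
        - s * (s - z) * (2 * (((2 * b * s - y) * (s - z) + (s - y) * (2 * b * s)) + (2 * b * s * (s - z) + s * (2 * b * s))
            + (2 * b * s * (s - y) + s * (2 * b * s - y)))))
        / (2 * ((s - y) * (s - z) + s * (s - z) + s * (s - y))) ^ 2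
      = (a / 2 + bT) / s - (a / s) ^ 2 / 2 := by
  rw [hF, hbT, ha, hb, hy]
  field_simp
  rw [hP, hq]
  ring

/-- ★★ **THE SECOND CUMULANT OF THE PERRON ROOT IS THE DERIVATIVE OF THE CONTACT DENSITY**: for every `A` (and `y = e^A`),
`d/dA b(e^A, z) = (a/2 + b_T)/s − (a/s)²/2` with `a = perronTaylorA y z`, `b_T = perronTaylorB y z`, `s = μ₁(y,z)²` — the quadratic coefficient
`γ` of `log(s(t)/s) = iαt − γt² + O(|t|³)` (`…WidthOneComplexTaylor.exists_norm_log_root_div_sub_le`).  Since the CLT variance of the contact number is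
`σ² = d/dA b(e^A,z)|_{A = log y}` (`tendsto_contactLaw`), this says `γ = σ²`.  Proof: implicit differentiation of `b = s(s−z)/(2F(y,s))` with
`ds/dA = 2bs = a`. [cite: BeatonBousquetMelouDeGierDuminilCopinGuttmann2014, §3.2 Proposition 6 (arXiv v5 p. 10; lane statement); DemboZeitouni2010, §2.3] -/
theorem hasDerivAt_contactB_exp_perron (hz : 0 < z) (A : ℝ) :
    HasDerivAt (fun A => contactB (Real.exp A) z)
      ((perronTaylorA (Real.exp A) z / 2 + perronTaylorB (Real.exp A) z) / stripMuY₂ 1 (Real.exp A) z ^ 2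
        - (perronTaylorA (Real.exp A) z / stripMuY₂ 1 (Real.exp A) z ^ 2) ^ 2 / 2) A := by
  have hy : 0 < Real.exp A := Real.exp_pos A
  obtain ⟨hys, hzs, hF, hsex, -, -⟩ := contactB_facts hy hz
  obtain ⟨hrelA, hrelB⟩ := perronTaylor_relations hy hz
  have hS := hasDerivAt_stripMuY₂_sq_exp hz A
  have hE : HasDerivAt (fun A => Real.exp A) (Real.exp A) A := Real.hasDerivAt_exp A
  -- numerator and denominator of `b = S(S − z)/(2F)`
  have hnum : HasDerivAt (fun A => stripMuY₂ 1 (Real.exp A) z ^ 2 * (stripMuY₂ 1 (Real.exp A) z ^ 2 - z))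
      (2 * contactB (Real.exp A) z * stripMuY₂ 1 (Real.exp A) z ^ 2 * (stripMuY₂ 1 (Real.exp A) z ^ 2 - z)
        + stripMuY₂ 1 (Real.exp A) z ^ 2 * (2 * contactB (Real.exp A) z * stripMuY₂ 1 (Real.exp A) z ^ 2)) A :=
    hS.mul (hS.sub_const z)
  have hden : HasDerivAt (fun A => 2 * ((stripMuY₂ 1 (Real.exp A) z ^ 2 - Real.exp A) * (stripMuY₂ 1 (Real.exp A) z ^ 2 - z)
        + stripMuY₂ 1 (Real.exp A) z ^ 2 * (stripMuY₂ 1 (Real.exp A) z ^ 2 - z)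
        + stripMuY₂ 1 (Real.exp A) z ^ 2 * (stripMuY₂ 1 (Real.exp A) z ^ 2 - Real.exp A)))
      (2 * (((2 * contactB (Real.exp A) z * stripMuY₂ 1 (Real.exp A) z ^ 2 - Real.exp A) * (stripMuY₂ 1 (Real.exp A) z ^ 2 - z)
            + (stripMuY₂ 1 (Real.exp A) z ^ 2 - Real.exp A) * (2 * contactB (Real.exp A) z * stripMuY₂ 1 (Real.exp A) z ^ 2))
          + (2 * contactB (Real.exp A) z * stripMuY₂ 1 (Real.exp A) z ^ 2 * (stripMuY₂ 1 (Real.exp A) z ^ 2 - z)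
              + stripMuY₂ 1 (Real.exp A) z ^ 2 * (2 * contactB (Real.exp A) z * stripMuY₂ 1 (Real.exp A) z ^ 2))
          + (2 * contactB (Real.exp A) z * stripMuY₂ 1 (Real.exp A) z ^ 2 * (stripMuY₂ 1 (Real.exp A) z ^ 2 - Real.exp A)
              + stripMuY₂ 1 (Real.exp A) z ^ 2 * (2 * contactB (Real.exp A) z * stripMuY₂ 1 (Real.exp A) z ^ 2 - Real.exp A)))) A := by
    have h1 : HasDerivAt (fun A => (stripMuY₂ 1 (Real.exp A) z ^ 2 - Real.exp A) * (stripMuY₂ 1 (Real.exp A) z ^ 2 - z))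
        ((2 * contactB (Real.exp A) z * stripMuY₂ 1 (Real.exp A) z ^ 2 - Real.exp A) * (stripMuY₂ 1 (Real.exp A) z ^ 2 - z)
          + (stripMuY₂ 1 (Real.exp A) z ^ 2 - Real.exp A) * (2 * contactB (Real.exp A) z * stripMuY₂ 1 (Real.exp A) z ^ 2)) A :=
      (hS.sub hE).mul (hS.sub_const z)
    have h3 : HasDerivAt (fun A => stripMuY₂ 1 (Real.exp A) z ^ 2 * (stripMuY₂ 1 (Real.exp A) z ^ 2 - Real.exp A))
        (2 * contactB (Real.exp A) z * stripMuY₂ 1 (Real.exp A) z ^ 2 * (stripMuY₂ 1 (Real.exp A) z ^ 2 - Real.exp A)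
          + stripMuY₂ 1 (Real.exp A) z ^ 2 * (2 * contactB (Real.exp A) z * stripMuY₂ 1 (Real.exp A) z ^ 2 - Real.exp A)) A :=
      hS.mul (hS.sub hE)
    exact ((h1.add hnum).add h3).const_mul 2
  have hden0 : 2 * ((stripMuY₂ 1 (Real.exp A) z ^ 2 - Real.exp A) * (stripMuY₂ 1 (Real.exp A) z ^ 2 - z)
      + stripMuY₂ 1 (Real.exp A) z ^ 2 * (stripMuY₂ 1 (Real.exp A) z ^ 2 - z)
      + stripMuY₂ 1 (Real.exp A) z ^ 2 * (stripMuY₂ 1 (Real.exp A) z ^ 2 - Real.exp A)) ≠ 0 := by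
    have : sexticDeriv (Real.exp A) z (stripMuY₂ 1 (Real.exp A) z ^ 2)
        = (stripMuY₂ 1 (Real.exp A) z ^ 2 - Real.exp A) * (stripMuY₂ 1 (Real.exp A) z ^ 2 - z)
          + stripMuY₂ 1 (Real.exp A) z ^ 2 * (stripMuY₂ 1 (Real.exp A) z ^ 2 - z)
          + stripMuY₂ 1 (Real.exp A) z ^ 2 * (stripMuY₂ 1 (Real.exp A) z ^ 2 - Real.exp A) := rfl
    rw [← this]; positivity
  have hdiv := hnum.div hden hden0
  have hfun : ((fun A => stripMuY₂ 1 (Real.exp A) z ^ 2 * (stripMuY₂ 1 (Real.exp A) z ^ 2 - z)) /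
      (fun A => 2 * ((stripMuY₂ 1 (Real.exp A) z ^ 2 - Real.exp A) * (stripMuY₂ 1 (Real.exp A) z ^ 2 - z)
        + stripMuY₂ 1 (Real.exp A) z ^ 2 * (stripMuY₂ 1 (Real.exp A) z ^ 2 - z)
        + stripMuY₂ 1 (Real.exp A) z ^ 2 * (stripMuY₂ 1 (Real.exp A) z ^ 2 - Real.exp A)))) = fun A => contactB (Real.exp A) z := by
    funext A; simp only [Pi.div_apply]; rfl
  rw [hfun] at hdiv
  refine hdiv.congr_deriv ?_
  -- the algebra
  set s := stripMuY₂ 1 (Real.exp A) z ^ 2 with hs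
  set y := Real.exp A with hy'
  set b := contactB y z with hb
  set a := perronTaylorA y z with ha
  set bT := perronTaylorB y z with hbT
  have hs0 : 0 < s := hy.trans hys
  have hbdef : b = s * (s - z) / (2 * ((s - y) * (s - z) + s * (s - z) + s * (s - y))) := by rw [hb]; rfl
  set q := s * s - z * s + z with hq
  have hq0 : 0 < q := by rw [hq]; nlinarith [mul_pos hs0 (sub_pos.2 hzs)]
  set F := (s - y) * (s - z) + s * (s - z) + s * (s - y) with hFdef
  set P := F * q with hPdef
  have hP0 : P ≠ 0 := mul_ne_zero hF.ne' hq0.ne'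
  have hyq : y * q = s * s * (s - z) := by rw [hq]; linear_combination (-1 : ℝ) * hsex
  have hyq' : y = s * s * (s - z) / q := by rw [eq_div_iff hq0.ne', hyq]
  have hFq : F = P / q := by rw [hPdef, mul_div_cancel_right₀ _ hq0.ne']
  have haF : F * a = s * s * (s - z) := by rw [← hyq]; linear_combination hrelA
  have ha' : a = s * s * (s - z) * q / P := by
    rw [eq_div_iff hP0, hPdef]; linear_combination q * haF
  have hb' : b = s * (s - z) * q / (2 * P) := by
    rw [hbdef, hFq]; field_simp
  have hbT' : bT = (y * (2 * s - z) * a - (3 * s - z - y) * a ^ 2) * q / P := by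
    rw [eq_div_iff hP0, hPdef]; linear_combination q * hrelB
  have hPpoly : P = 3 * s * s * q - 2 * s ^ 3 * (s - z) - 2 * z * s * q + z * s * s * (s - z) := by
    rw [hPdef, hFdef]; linear_combination (z - 2 * s) * hyq
  exact second_cumulant_algebra hs0.ne' hq0.ne' hP0 hq hPpoly hyq' hFq hb' ha' hbT'

/-- ★★ **`σ² = γ`**: the CLT variance of the contact number, `σ² = d/dA b(e^A,z)|_{A = log y}` (`…WidthOneContactCLT.tendsto_contactLaw`), equals the quadratic
cumulant `γ = (a/2 + b_T)/s − (a/s)²/2` of the complex Perron root. [cite: BeatonBousquetMelouDeGierDuminilCopinGuttmann2014, §3.2 Proposition 6 (arXiv v5 p. 10; lane statement); DemboZeitouni2010, §2.3] -/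
theorem deriv_contactB_exp_eq_perron (hy : 0 < y) (hz : 0 < z) :
    deriv (fun A => contactB (Real.exp A) z) (Real.log y)
      = (perronTaylorA y z / 2 + perronTaylorB y z) / stripMuY₂ 1 y z ^ 2 - (perronTaylorA y z / stripMuY₂ 1 y z ^ 2) ^ 2 / 2 := by
  have h := (hasDerivAt_contactB_exp_perron hz (Real.log y)).deriv
  rwa [Real.exp_log hy] at h

end WidthOneYZ

end Literature.Probability.RandomPlanarGeometry.SAW.HexBW

end
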